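import Mathlib
import Summits.Ventures.HodgeRepro2.T6N5Hyp
import Summits.Ventures.HodgeRepro2.T6N5LocalDatum
import Summits.Ventures.HodgeRepro2.T6N5LocalHyp
import Summits.Ventures.HodgeRepro2.T6N5Local
import Summits.Ventures.HodgeRepro2.T6N5LocalWeil
import Summits.Ventures.HodgeRepro2.T6N5LocalCharDatum
import Summits.Ventures.HodgeRepro2.T6N5LocalInertHyp
import Summits.Ventures.HodgeRepro2.T6N5LocalInert

/-!
# T6N5LocalInertWeil — Tier 6, M2 sub-step N5 (t6-p8's half): THEOREM N5.T2 at an inert place with BOTH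
residual binders discharged — (A1) from the carried Weil representation (`T6N5LocalWeil`) and case (iii) from
Gan–Gross–Prasad's Proposition 3.1 + Tate's (3.2.2)–(3.2.3) + conductor arithmetic (`T6N5LocalInert`)

`InertWeilDatum` = the conductor-graded inert datum `D` together with the Weil representations of the two
hermitian lines (the fields of `T6N5LocalWeil.WeilLocalDatum` over `D`'s characters); `toWeil` is the
`WeilLocalDatum` with `base := D.toLocalSignDatum`, whose theta predicate is DEFINED from the Weil representation.
`N5Local_main_inert_weil` is `N5Local_main_of_weil` with its binder `hiii` supplied by `hiii_of_inert` — so that at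
an inert place the coupled local system of TIER5 §N5.11.5 is solved from the three displays (Epsilon Dichotomy,
Proposition 3.1, Tate (3.2.2)–(3.2.3)) and DATUM conditions only: no interface residual remains.
README §8(d): uses an L-value-free non-vanishing device: NO.
-/

namespace Summit.Ventures.HodgeRepro2.T6.N5LocalInertWeil

open Summit.Ventures.HodgeRepro2.T6.N5LocalDatum Summit.Ventures.HodgeRepro2.T6.N5LocalWeil
  Summit.Ventures.HodgeRepro2.T6.N5LocalCharDatum Summit.Ventures.HodgeRepro2.T6.N5LocalCharDatum.CharDatum
  Summit.Ventures.HodgeRepro2.T6.N5LocalInertDatum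
  Summit.Ventures.HodgeRepro2.T6.N5Local Summit.Ventures.HodgeRepro2.T6.N5LocalInert
  Summit.Ventures.HodgeRepro2.T6.Hyp

/-- The inert conductor-graded datum together with the carried Weil representations of the two hermitian lines
(data only; the Weil fields as in `T6N5LocalWeil.WeilLocalDatum`). -/
structure InertWeilDatum where
  /-- the conductor-graded local sign datum at the inert place. -/
  D : InertSignDatum
  /-- `U(V) = E¹_v` as an additive abelian group. -/
  A : Type
  [instA : AddCommGroup A]
  /-- the space of the Weil representation of the line `V_s` restricted to `U(V_s)`. -/
  Wsp : ℤˣ → Type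
  [instW : ∀ s, AddCommGroup (Wsp s)]
  [instWm : ∀ s, Module ℂ (Wsp s)]
  /-- the Weil representation `ω_{V_s,W,ι̃,ψ}` restricted to `U(V_s) = E¹_v`. -/
  ωWeil : ∀ s, Representation ℂ (Multiplicative A) (Wsp s)
  /-- `α ↦ α_K = α ∘ j`. -/
  ofOne : AddChar A ℂ → (D.E →* ℂˣ)

attribute [instance] InertWeilDatum.instA InertWeilDatum.instW InertWeilDatum.instWm

namespace InertWeilDatum

variable (X : InertWeilDatum)

/-- The Weil local datum over the inert datum's local sign datum (theta predicate defined from the Weil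
representation). -/
noncomputable abbrev toWeil : WeilLocalDatum where
  base := X.D.toLocalSignDatum
  A := X.A
  Wsp := X.Wsp
  ωWeil := X.ωWeil
  ofOne := X.ofOne

/-- THEOREM N5.T2 AT AN INERT PLACE, BOTH RESIDUALS DISCHARGED: the coupled local system is solvable from the
displays `Hyp.BFGYYZ2025_Thm3_5` (Epsilon Dichotomy), `Hyp.GGP2012ex_Prop3_1` (the inert parity rule) and
`Hyp.Tate1979_3_2_2_3` (the twisting law) and the datum conditions of `T6N5LocalInert.N5Local_main_inert` /
`T6N5LocalWeil.N5Local_main_of_weil` (the normalisation conventions, the filtration, `ψ_δ = ψ₀(t·)`, `η_v(t)`,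
the inert / normalised predicates, the unramified conjugate-symplectic `μ`, the conjugate-orthogonal characters of
every exact conductor, the non-vanishing and smoothness of the Weil representations, `j(F_v^×) = 1`,
`ϵ_δ(W) = 1`, `η_v² = 1`, `χ_W` conjugate-symplectic). -/
theorem N5Local_main_inert_weil (hG : GGP2012ex_Prop3_1 X.D)
    (hT : Tate1979_3_2_2_3 X.D.epsT (fun ξ a => ((ξ a : ℂˣ) : ℂ)) X.D.tw X.D.sc X.D.nrm (fun _ => True))
    (hc : X.D.toCharDatum.Conventions) (hU : Antitone X.D.U) (hψδ : X.D.ψδ = X.D.tw X.D.ψ0 X.D.t) (ht : X.D.t ∈ X.D.Fsub)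
    (hηt : ((X.D.η ⟨X.D.t, ht⟩ : ℂˣ) : ℂ) = (-1 : ℂ) ^ (X.D.d + 1))
    (hin : X.D.IsInert) (hψ0 : X.D.IsNormalised X.D.ψ0)
    (hμ : ∃ μ : X.D.E →* ℂˣ, X.D.toLocalSignDatum.IsCS μ ∧ X.D.IsUnramified μ)
    (hβ : ∀ n : ℕ, 1 ≤ n → ∃ β : X.D.E →* ℂˣ, X.D.toLocalSignDatum.IsCO β ∧ X.D.IsSmooth β ∧ X.D.cond β = n)
    (h35 : BFGYYZ2025_Thm3_5 X.toWeil.toLocalSignDatum)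
    (hsm : ∀ s, X.toWeil.IsSmoothCompact s) [∀ s, Nontrivial (X.Wsp s)]
    (hofOne : ∀ α, X.toWeil.toLocalSignDatum.IsCO (X.toWeil.ofOne α))
    (hW : X.toWeil.toLocalSignDatum.epsdW = 1)
    (hη : X.toWeil.toLocalSignDatum.η * X.toWeil.toLocalSignDatum.η = 1)
    (hχW : X.toWeil.toLocalSignDatum.IsCS X.toWeil.toLocalSignDatum.χW) :
    ∃ ξ : Fin 4 → X.toWeil.toLocalSignDatum.Char, LocalSolution X.toWeil.toLocalSignDatum ξ :=
  X.toWeil.N5Local_main_of_weil h35 hsm hofOne hW hη hχW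
    (fun _ _ => hiii_of_inert X.D hG hT hc hU hψδ ht hηt hin hψ0 hμ hβ)

end InertWeilDatum

end Summit.Ventures.HodgeRepro2.T6.N5LocalInertWeil
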